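import Summits.ValiantsHypothesis.ValiantsHypothesis.Theorems.GrenetZeonPolySizeQPAlgebraHomogeneousCorner
import HarnessLib

/-!
# Crux `GrenetZeon.PolySizeQPAlgebra` (stmt-ValiantsHypothesis-8064) — the SUB-TOP component of an affine
# determinant and the normal form of the corner `m = n + 1`

Companion to `GrenetZeonPolySizeQPAlgebraHomogeneousCorner.lean` (degree-`k` component of the determinant of
an affine `k × k` matrix = determinant of the linear parts).  Here: for an affine `(k+1) × (k+1)` matrix `A`
with matrix of linear parts `L = A.map (homogeneousComponent 1)` and constant part `A(0)` (entries
`C (coeff 0 (A i j))`), the degree-`k` component of `det A` is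

  `(det A)_k = Σ_j det (L with column j from A(0)) = tr (adj L · A(0))`

(`homogeneousComponent_det_pred`, `homogeneousComponent_det_pred_eq_trace`; any commutative ring; Leibniz
expansion with exactly one constant factor).  Consequence for the piece (`c = 1` box, the half `m = n + 1`):
an `(n+1, s)`-representation `(R, λ, A)` of a form `f` of degree `n` satisfies
`f = λ (tr (adj L · A(0)))` coefficientwise (`subtop_repr_of_isHomogeneous`) — the dual-jet shape of crux
stmt-8062, now over the coefficient algebra `R` and with `L` LINEAR; for `per_n` this is
`perPoly_eq_subtop`.  Honest framing: a normal form, no exclusion; stubs of 8064 untouched; nothing here bears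
on VP ≠ VNP.  Axioms `propext`, `Classical.choice`, `Quot.sound`.
-/

set_option linter.dupNamespace false

noncomputable section

namespace Summit.ValiantsHypothesis.ValiantsHypothesis.Theorems.GrenetZeonPolySizeQPAlgebra

open MvPolynomial Matrix
open Literature.Computability.AlgebraicComplexity

section Subtop

variable {σ : Type*} {S : Type*} [CommRing S]

/-- An affine form is its constant plus its linear part. [folklore] -/
theorem eq_C_add_homogeneousComponent_one {u : MvPolynomial σ S} (hu : u.totalDegree ≤ 1) :
    u = C (coeff 0 u) + homogeneousComponent 1 u := by
  classical
  ext d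
  rw [coeff_add, coeff_C, coeff_homogeneousComponent]
  by_cases h0 : 0 = d
  · subst h0
    simp
  · rw [if_neg h0, zero_add]
    by_cases h1 : d.degree = 1
    · rw [if_pos h1]
    · rw [if_neg h1]
      apply coeff_eq_zero_of_totalDegree_lt
      rw [← Finsupp.degree_apply]
      have hd : d.degree ≠ 0 := fun h => h0 ((Finsupp.degree_eq_zero_iff d).mp h).symm
      omega

/-- Multiplying by a linear form shifts homogeneous components by one. [folklore] -/
theorem homogeneousComponent_succ_mul_of_isHomogeneous_one {ℓ v : MvPolynomial σ S}
    (hℓ : ℓ.IsHomogeneous 1) (n : ℕ) :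
    homogeneousComponent (n + 1) (ℓ * v) = ℓ * homogeneousComponent n v := by
  classical
  ext d
  rw [coeff_homogeneousComponent]
  split_ifs with hd
  · -- both sides: Σ over antidiagonal, only |d₁| = 1 terms of ℓ survive
    rw [coeff_mul, coeff_mul]
    refine Finset.sum_congr rfl fun x hx => ?_
    rw [Finset.HasAntidiagonal.mem_antidiagonal] at hx
    rw [coeff_homogeneousComponent]
    split_ifs with h2
    · rfl
    · by_cases hx1 : x.1.degree = 1
      · exfalso
        apply h2
        have : x.1.degree + x.2.degree = n + 1 := by rw [← map_add, hx, hd]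
        omega
      · rw [hℓ.coeff_eq_zero hx1, zero_mul, zero_mul]
  · -- RHS coefficient vanishes: ℓ * hc_n v is homogeneous of degree n + 1
    symm
    exact (hℓ.mul (homogeneousComponent_isHomogeneous n v)).coeff_eq_zero (by omega)

/-- Components of an affine multiple: `(u v)_{n+1} = u(0) · v_{n+1} + u_1 · v_n` for `deg u ≤ 1`.
[folklore] -/
theorem homogeneousComponent_succ_mul_of_totalDegree_le_one {u v : MvPolynomial σ S}
    (hu : u.totalDegree ≤ 1) (n : ℕ) :
    homogeneousComponent (n + 1) (u * v) =
      C (coeff 0 u) * homogeneousComponent (n + 1) v +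
        homogeneousComponent 1 u * homogeneousComponent n v := by
  conv_lhs => rw [eq_C_add_homogeneousComponent_one hu]
  rw [add_mul, map_add, homogeneousComponent_C_mul,
    homogeneousComponent_succ_mul_of_isHomogeneous_one (homogeneousComponent_isHomogeneous 1 u)]

/-- **Sub-top component of a product of affine forms:** the terms with exactly one constant factor,
`(∏_{i∈s} p_i)_{|s|-1} = Σ_{i∈s} p_i(0) · ∏_{j ≠ i} (p_j)_1` (`s` non-empty). [folklore] -/
theorem homogeneousComponent_prod_pred {ι : Type*} [DecidableEq ι] (s : Finset ι) (hs : s.Nonempty)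
    (p : ι → MvPolynomial σ S) (hp : ∀ i ∈ s, (p i).totalDegree ≤ 1) :
    homogeneousComponent (s.card - 1) (∏ i ∈ s, p i) =
      ∑ i ∈ s, C (coeff 0 (p i)) * ∏ j ∈ s.erase i, homogeneousComponent 1 (p j) := by
  induction s using Finset.induction_on with
  | empty => exact absurd hs Finset.not_nonempty_empty
  | insert a t ha ih =>
    have ht : ∀ i ∈ t, (p i).totalDegree ≤ 1 := fun i hi => hp i (Finset.mem_insert_of_mem hi)
    have hpa : (p a).totalDegree ≤ 1 := hp a (Finset.mem_insert_self a t)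
    rw [Finset.prod_insert ha, Finset.sum_insert ha, Finset.erase_insert ha,
      Finset.card_insert_of_notMem ha]
    rcases t.eq_empty_or_nonempty with rfl | htne
    · simp [homogeneousComponent_zero]
    · -- `|t| = (|t| - 1) + 1`
      obtain ⟨k, hk⟩ : ∃ k, t.card = k + 1 := ⟨t.card - 1, by
        have := Finset.card_pos.mpr htne; omega⟩
      have ih' := ih htne ht
      rw [hk, Nat.add_sub_cancel] at ih'
      rw [hk, Nat.add_sub_cancel, homogeneousComponent_succ_mul_of_totalDegree_le_one hpa, ih',
        ← hk, ← homogeneousComponent_prod_of_totalDegree_le_one t p ht, Finset.mul_sum]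
      congr 1
      refine Finset.sum_congr rfl fun i hi => ?_
      rw [Finset.erase_insert_of_ne (by rintro rfl; exact ha hi),
        Finset.prod_insert (fun h => ha (Finset.mem_of_mem_erase h))]
      ring

/-- **Sub-top component of an affine determinant.** For an affine `(k+1) × (k+1)` matrix `A`,
`(det A)_k = Σ_j det (L with its j-th column replaced by the constants A(0)_{·j})`, `L` the matrix of linear
parts. [folklore] -/
theorem homogeneousComponent_det_pred {k : ℕ} (A : Matrix (Fin (k + 1)) (Fin (k + 1)) (MvPolynomial σ S))
    (hA : ∀ i j, (A i j).totalDegree ≤ 1) :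
    homogeneousComponent k A.det =
      ∑ j, ((A.map (homogeneousComponent 1)).updateCol j fun i => C (coeff 0 (A i j))).det := by
  classical
  have hcard : (Finset.univ : Finset (Fin (k + 1))).card - 1 = k := by simp
  rw [Matrix.det_apply, map_sum]
  simp_rw [Matrix.det_apply]
  rw [Finset.sum_comm]
  refine Finset.sum_congr rfl fun τ _ => ?_
  have hB := homogeneousComponent_prod_pred (Finset.univ : Finset (Fin (k + 1))) Finset.univ_nonempty
    (fun i => A (τ i) i) (fun i _ => hA _ _)
  rw [hcard] at hB
  rw [Units.smul_def, map_zsmul, hB]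
  simp_rw [Units.smul_def]
  rw [← Finset.smul_sum]
  congr 1
  refine Finset.sum_congr rfl fun j _ => ?_
  rw [← Finset.prod_erase_mul Finset.univ _ (Finset.mem_univ j), Matrix.updateCol_self, mul_comm]
  congr 1
  exact Finset.prod_congr rfl fun i hi => by
    rw [Matrix.updateCol_ne (Finset.ne_of_mem_erase hi), Matrix.map_apply]

/-- Trace form: `(det A)_k = tr (adj L · A(0))`. [folklore] -/
theorem homogeneousComponent_det_pred_eq_trace {k : ℕ}
    (A : Matrix (Fin (k + 1)) (Fin (k + 1)) (MvPolynomial σ S)) (hA : ∀ i j, (A i j).totalDegree ≤ 1) :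
    homogeneousComponent k A.det =
      ((A.map (homogeneousComponent 1)).adjugate * A.map fun p => C (coeff 0 p)).trace := by
  rw [homogeneousComponent_det_pred A hA, trace_adjugate_mul_eq_sum_det_updateCol]
  rfl

end Subtop

/-! ### Normal form of the corner `m = n + 1` -/

section Repr

universe u

variable {k : Type u} [CommRing k] {σ : Type*}

/-- **The corner `m = deg f + 1`.** If a form `f` of degree `n` has an `(n+1, s)`-representation
`(R, λ, A)`, then `f = λ (tr (adj L · A(0)))` coefficientwise, with `L` the (linear) matrix of linear parts
and `A(0)` the constant part — the dual-jet shape over the coefficient algebra. [folklore] -/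
theorem subtop_repr_of_isHomogeneous {f : MvPolynomial σ k} {n s : ℕ} (hf : f.IsHomogeneous n)
    (h : HasAlgDetRepr f (n + 1) s) :
    ∃ (R : Type u) (_ : CommRing R) (_ : Algebra k R) (_ : Module.Finite k R),
      Module.finrank k R ≤ s ∧ ∃ (l : R →ₗ[k] k)
        (L : Matrix (Fin (n + 1)) (Fin (n + 1)) (MvPolynomial σ R)) (A₀ : Matrix (Fin (n + 1)) (Fin (n + 1)) R),
        (∀ i j, (L i j).IsHomogeneous 1) ∧
          ∀ d : σ →₀ ℕ, l (MvPolynomial.coeff d (L.adjugate * A₀.map C).trace) = MvPolynomial.coeff d f := by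
  obtain ⟨R, _, _, _, hR, l, A, hA, hcoeff⟩ := h
  refine ⟨R, inferInstance, inferInstance, inferInstance, hR, l, A.map (homogeneousComponent 1),
    A.map (coeff 0), isHomogeneous_map_homogeneousComponent_one A, fun d => ?_⟩
  have hmap : (A.map (coeff 0)).map (C : R →+* MvPolynomial σ R) = A.map fun p => C (coeff 0 p) := by
    ext i j; rfl
  rw [hmap, ← homogeneousComponent_det_pred_eq_trace A hA, coeff_homogeneousComponent]
  split_ifs with hd
  · exact hcoeff d
  · rw [map_zero, hf.coeff_eq_zero hd]

end Repr

/-- **The permanent at `m = n + 1`:** any `(n+1, s)`-representation `(R, λ, A)` of `per_n` reads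
`per_n = λ (tr (adj L · A(0)))` coefficientwise with `L` linear. [folklore] -/
theorem perPoly_eq_subtop {n s : ℕ} (h : HasAlgDetRepr (perPoly (Fin n) ℂ) (n + 1) s) :
    ∃ (R : Type) (_ : CommRing R) (_ : Algebra ℂ R) (_ : Module.Finite ℂ R),
      Module.finrank ℂ R ≤ s ∧ ∃ (l : R →ₗ[ℂ] ℂ)
        (L : Matrix (Fin (n + 1)) (Fin (n + 1)) (MvPolynomial (Fin n × Fin n) R))
        (A₀ : Matrix (Fin (n + 1)) (Fin (n + 1)) R),
        (∀ i j, (L i j).IsHomogeneous 1) ∧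
          ∀ d : (Fin n × Fin n) →₀ ℕ,
            l (MvPolynomial.coeff d (L.adjugate * A₀.map C).trace) = MvPolynomial.coeff d (perPoly (Fin n) ℂ) := by
  have hper : (perPoly (Fin n) ℂ).IsHomogeneous n := by
    have h := perPoly_isHomogeneous (n := Fin n) (k := ℂ)
    rwa [Fintype.card_fin] at h
  exact subtop_repr_of_isHomogeneous hper h

end Summit.ValiantsHypothesis.ValiantsHypothesis.Theorems.GrenetZeonPolySizeQPAlgebra

end
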